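import Summits.Schanuel.Schanuel.Theorems.RootDecomp1KGeneric08

/-!
# RootDecomp1K — «GENERIC CELLS», part 09: Piece KS (Kummer specialisation) — Step A / Step B polynomial packages, integer relations, the currency `ε_k`

Provenance: ROOT DECOMPOSITION CELL decomp-schanuel (D-0178), lens 6 «barrier-complement carving»,
gen 13, Stage D; source `KS.lean` (lens publication dir `decomp-schanuel-lens-6/g13/addendum/`).
Supports `stmt-Schanuel-33363` (A₄ʰ `HyperLiouvilleSchanuel`) via the glued split of
`Theorems/RootDecomp1KGeneric02` (`hyperLiouvilleSchanuel_live_of_pieces`): this series of parts 08–11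
PROVES Piece KS (`KummerSpecialisation`, `@[conjecture] def` of part 01) outright.

Contents: §4 `alpha_poly` (integer polynomial of `α = γ^q` via `resPoly`); §5 `beta_poly` (integer polynomial of
`β` via the conjugate product), `irreducible_package`, `eval_conjFactor_kspec`; §6 integer relations from
`¬ AlgebraicIndependent` / `IsAlgebraic (adjoin)`; §7 the currency `ε_k = exp(−q^k)` and absorption lemmas.
-/

noncomputable section

open Complex Polynomial

namespace Summit.Schanuel.Schanuel.Theorems.RootDecomp1KGeneric

open Summit.Schanuel.Schanuel.Theorems.RootDecomp1KHyper
open Summit.Schanuel.Schanuel.Theorems.RootDecomp1KHyper.HyperCell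

open MvPolynomial in
/-- Every rational polynomial has a nonzero integer multiple with integer coefficients
(private copy of the part-08 lemma). -/
private theorem exists_int_mul_mvPolynomial {σ : Type*} (P : MvPolynomial σ ℚ) :
    ∃ (c : ℤ) (Q : MvPolynomial σ ℤ), c ≠ 0 ∧
      MvPolynomial.map (Int.castRingHom ℚ) Q = MvPolynomial.C (c : ℚ) * P := by
  induction P using MvPolynomial.induction_on with
  | C a =>
    refine ⟨(a.den : ℤ), MvPolynomial.C a.num, by exact_mod_cast a.den_ne_zero, ?_⟩
    rw [MvPolynomial.map_C, eq_intCast, ← map_mul]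
    congr 1
    push_cast
    rw [mul_comm, Rat.mul_den_eq_num]
  | add P₁ P₂ hP₁ hP₂ =>
    obtain ⟨c₁, Q₁, hc₁, h₁⟩ := hP₁
    obtain ⟨c₂, Q₂, hc₂, h₂⟩ := hP₂
    refine ⟨c₁ * c₂, MvPolynomial.C c₂ * Q₁ + MvPolynomial.C c₁ * Q₂, mul_ne_zero hc₁ hc₂, ?_⟩
    rw [map_add, map_mul, map_mul, MvPolynomial.map_C, MvPolynomial.map_C, h₁, h₂]
    simp only [eq_intCast, Int.cast_mul, map_mul]
    ring
  | mul_X P n hP =>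
    obtain ⟨c, Q, hc, h⟩ := hP
    refine ⟨c, Q * MvPolynomial.X n, hc, ?_⟩
    rw [map_mul, MvPolynomial.map_X, h, mul_assoc]

/-! ## KS 4. Step A: the Kummer root `γ ≈ e^{u/q}`, `α = γ^q`, and the integer polynomial of `α` -/

/-- A nonzero integer polynomial with a value of modulus `< 1` somewhere has positive degree. -/
theorem natDegree_pos_of_norm_aeval_lt_one {A : ℤ[X]} (hA : A ≠ 0) {w : ℂ} (hw : ‖aeval w A‖ < 1) :
    0 < A.natDegree := by
  by_contra h
  push Not at h
  have h0 : A.natDegree = 0 := by omega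
  rw [Polynomial.eq_C_of_natDegree_eq_zero h0, aeval_C, algebraMap_int_eq, eq_intCast,
    Complex.norm_intCast] at hw
  have hc : A.coeff 0 ≠ 0 := by
    intro hc; apply hA; rw [Polynomial.eq_C_of_natDegree_eq_zero h0, hc, map_zero]
  have : (1 : ℝ) ≤ |(A.coeff 0 : ℝ)| := by exact_mod_cast Int.one_le_abs hc
  linarith

/-- The resultant family of `Y − V^q` (`G₀ = −V^q`, `G₁ = 1`): `conjFactor (kumY q) γ = Y − γ^q`. -/
def kumY (q : ℕ) : Fin 2 → ℤ[X] := ![-(X ^ q), 1]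

/-- The last entry of the Kummer pair `kumY q = (−X^q, 1)` is `1`. -/
theorem kumY_last (q : ℕ) : kumY q (Fin.last 1) = 1 := rfl

/-- The conjugate factor of `kumY q` at `γ` evaluates to `y − γ^q`. -/
theorem eval_conjFactor_kumY (q : ℕ) (γ y : ℂ) : (conjFactor (kumY q) γ).eval y = y - γ ^ q := by
  rw [eval_conjFactor, Fin.sum_univ_two]
  simp [kumY]
  ring

/-- Each entry of `kumY q` has degree at most `q`. -/
theorem natDegree_kumY_le (q : ℕ) : ∀ k, (kumY q k).natDegree ≤ q := by
  intro k
  fin_cases k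
  · simp [kumY]
  · simp [kumY]

/-- The relation length of `kumY q` is at most `2`. -/
theorem relLen_kumY (q : ℕ) : relLen (kumY q) ≤ 2 := by
  rw [relLen, Fin.sum_univ_two]
  have h0 : len (kumY q 0) ≤ 1 := by
    show len (-(X ^ q)) ≤ 1
    unfold len
    rw [natDegree_neg, natDegree_X_pow, Finset.sum_range_succ, Finset.sum_eq_zero]
    · simp
    · intro k hk
      rw [Finset.mem_range] at hk
      rw [coeff_neg, coeff_X_pow, if_neg (by omega)]; simp
  have h1 : len (kumY q 1) ≤ 1 := by
    show len (1 : ℤ[X]) ≤ 1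
    unfold len; simp
  have h0' : (len (kumY q 0) : ℝ) ≤ 1 := by exact_mod_cast h0
  have h1' : (len (kumY q 1) : ℝ) ≤ 1 := by exact_mod_cast h1
  linarith

/-- The integer polynomial of `α = γ^q`: `S = Res_V(r(V), Y − V^q)`. -/
theorem alpha_poly (r : ℤ[X]) (hr : r ≠ 0) {γ : ℂ} (hγ : aeval γ r = 0) (q : ℕ) :
    resPoly r (kumY q) q ≠ 0 ∧ aeval (γ ^ q) (resPoly r (kumY q) q) = 0 ∧
      (resPoly r (kumY q) q).natDegree ≤ r.natDegree ∧
      ((resPoly r (kumY q) q).map (Int.castRingHom ℂ)).mahlerMeasure ≤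
        2 ^ r.natDegree * (r.map (Int.castRingHom ℂ)).mahlerMeasure ^ q := by
  refine ⟨?_, ?_, ?_, ?_⟩
  · refine resPoly_ne_zero r hr (kumY q) (natDegree_kumY_le q) fun b _ => ?_
    rw [kumY_last, map_one]; exact one_ne_zero
  · exact aeval_resPoly_eq_zero r hr (kumY q) (natDegree_kumY_le q) hγ
      (by rw [eval_conjFactor_kumY, sub_self])
  · exact (natDegree_resPoly_le r (kumY q) (natDegree_kumY_le q)).trans (by simp)
  · refine (mahlerMeasure_resPoly_le r hr (kumY q) (natDegree_kumY_le q)).trans ?_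
    have h0 : 0 ≤ relLen (kumY q) := relLen_nonneg _
    have h2 : relLen (kumY q) ≤ 2 := relLen_kumY q
    have hM : 0 ≤ (r.map (Int.castRingHom ℂ)).mahlerMeasure ^ q :=
      pow_nonneg (mahlerMeasure_nonneg _) _
    gcongr

/-! ## KS 5. Step B: the conjugates of `γ`, the integer polynomial of `β ≈ u` -/

/-- If `γ` and `b` are roots of the same irreducible integer polynomial, an integer polynomial
that does not vanish at `γ` does not vanish at `b`. -/
theorem aeval_ne_zero_of_conjugate {g : ℤ[X]} (hg : Irreducible g) (hgd : 0 < g.natDegree)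
    {γ b : ℂ} (hγ : aeval γ g = 0) (hb : aeval b g = 0) {H : ℤ[X]} (hH : aeval γ H ≠ 0) :
    aeval b H ≠ 0 := by
  intro hbH
  obtain ⟨R, hR⟩ := dvd_of_irreducible_of_common_root hg hgd hb hbH
  apply hH
  rw [hR, map_mul, hγ, zero_mul]

/-- Mahler measure is monotone along divisibility of nonzero integer polynomials: `Q ∣ A ≠ 0 ⇒ M(Q) ≤ M(A)`
(private: the tree twin `Literature.NumberTheory.DiophantineApproximation.mahlerMeasure_map_le_of_dvd` lives outside this import cone). -/
private theorem mahlerMeasure_le_of_dvd_int {Q A : ℤ[X]} (hdvd : Q ∣ A) (hA : A ≠ 0) :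
    (Q.map (Int.castRingHom ℂ)).mahlerMeasure ≤ (A.map (Int.castRingHom ℂ)).mahlerMeasure := by
  obtain ⟨R, rfl⟩ := hdvd
  have hR : R ≠ 0 := right_ne_zero_of_mul hA
  rw [Polynomial.map_mul, mahlerMeasure_mul]
  calc (Q.map (Int.castRingHom ℂ)).mahlerMeasure = (Q.map (Int.castRingHom ℂ)).mahlerMeasure * 1 :=
        (mul_one _).symm
    _ ≤ _ := mul_le_mul_of_nonneg_left (one_le_mahlerMeasure_of_ne_zero hR) (mahlerMeasure_nonneg _)

open Literature.NumberTheory.Transcendental in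
/-- **The irreducible package.**  An algebraic `β` that is a root of a nonzero integer polynomial
`A` is a root of an IRREDUCIBLE integer polynomial `f ∣ A` of positive degree, with
`deg f ≤ deg A` and `M(f) ≤ M(A)`. -/
theorem irreducible_package {A : ℤ[X]} (hA : A ≠ 0) {β : ℂ} (hβ : aeval β A = 0) :
    ∃ f : ℤ[X], Irreducible f ∧ 0 < f.natDegree ∧ aeval β f = 0 ∧ f.natDegree ≤ A.natDegree ∧
      (f.map (Int.castRingHom ℂ)).mahlerMeasure ≤ (A.map (Int.castRingHom ℂ)).mahlerMeasure := by
  obtain ⟨f, hfirr, hfdeg, hfβ⟩ :=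
    NesterenkoWaldschmidt1996.exists_irreducible_int_aeval_eq_zero (isAlgebraic_of_aeval_int hA hβ)
  have hdvd : f ∣ A := dvd_of_irreducible_of_common_root hfirr hfdeg hfβ hβ
  exact ⟨f, hfirr, hfdeg, hfβ, Polynomial.natDegree_le_of_dvd hdvd hA,
    mahlerMeasure_le_of_dvd_int hdvd hA⟩

variable {L : ℕ}

/-- **The polynomial of β.**  `γ` a root of the irreducible `g`, `H_L(γ) ≠ 0`, `β` a root of
`Σ_l H_l(γ) X^l`: then `β` is a root of the nonzero integer polynomial `Res_V(g, Σ_l H_l(V) X^l)`,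
of degree `≤ deg g · L` and Mahler measure `≤ relLen H^{deg g} · M(g)^N`. -/
theorem beta_poly {g : ℤ[X]} (hg : Irreducible g) (hgd : 0 < g.natDegree) {γ : ℂ}
    (hγ : aeval γ g = 0) (H : Fin (L + 1) → ℤ[X]) {N : ℕ} (hN : ∀ l, (H l).natDegree ≤ N)
    (htop : aeval γ (H (Fin.last L)) ≠ 0) {β : ℂ} (hβ : (conjFactor H γ).eval β = 0) :
    resPoly g H N ≠ 0 ∧ aeval β (resPoly g H N) = 0 ∧ (resPoly g H N).natDegree ≤ g.natDegree * L ∧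
      ((resPoly g H N).map (Int.castRingHom ℂ)).mahlerMeasure ≤
        relLen H ^ g.natDegree * (g.map (Int.castRingHom ℂ)).mahlerMeasure ^ N := by
  have hg0 : g ≠ 0 := hg.ne_zero
  refine ⟨?_, aeval_resPoly_eq_zero g hg0 H hN hγ hβ, natDegree_resPoly_le g H hN,
    mahlerMeasure_resPoly_le g hg0 H hN⟩
  refine resPoly_ne_zero g hg0 H hN fun b hb => ?_
  have hb' : aeval b g = 0 := by
    rw [Polynomial.mem_roots (Polynomial.map_ne_zero_iff (RingHom.injective_int _) |>.mpr hg0),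
      IsRoot.def, eval_map_int] at hb
    exact hb
  exact aeval_ne_zero_of_conjugate hg hgd hγ hb' htop

/-- The value `Σ_l H_l(γ)·w^l` of the specialised relation, `H_l = kspec (Q l) D p q`. -/
theorem eval_conjFactor_kspec (Q : Fin (L + 1) → MvPolynomial (Fin 3) ℤ) {D : ℕ}
    (hD : ∀ l, ∀ s ∈ (Q l).support, s 1 ≤ D) (p : ℕ) {q : ℕ} (hq : q ≠ 0) (γ w : ℂ) :
    (conjFactor (fun l => kspec (Q l) D p q) γ).eval w =
      (q : ℂ) ^ D * ∑ l, MvPolynomial.aeval ![γ ^ q, (p : ℂ) / q, γ ^ p] (Q l) * w ^ (l : ℕ) := by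
  rw [eval_conjFactor, Finset.mul_sum]
  refine Finset.sum_congr rfl fun l _ => ?_
  rw [aeval_kspec (Q l) (hD l) p hq, mul_assoc]

/-- Closeness of the specialised relation value to the (vanishing) original one. -/
theorem norm_sum_aeval_sub_le (Q : Fin (L + 1) → MvPolynomial (Fin 3) ℤ) {E : ℕ}
    (hE : ∀ l, ∀ s ∈ (Q l).support, ∀ i, s i ≤ E) {M : ℝ} (hM : 1 ≤ M) (x y : Fin 3 → ℂ)
    (hx : ∀ i, ‖x i‖ ≤ M) (hy : ∀ i, ‖y i‖ ≤ M) (w : ℂ)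
    (hrel : ∑ l, MvPolynomial.aeval y (Q l) * w ^ (l : ℕ) = 0) :
    ‖∑ l, MvPolynomial.aeval x (Q l) * w ^ (l : ℕ)‖ ≤
      (∑ l, (lenMv (Q l) : ℝ)) * max 1 ‖w‖ ^ L * (E * M ^ (3 * E) * ∑ i, ‖x i - y i‖) := by
  rw [← sub_zero (∑ l, MvPolynomial.aeval x (Q l) * w ^ (l : ℕ)), ← hrel, ← Finset.sum_sub_distrib,
    Finset.sum_mul, Finset.sum_mul]
  refine (norm_sum_le _ _).trans (Finset.sum_le_sum fun l _ => ?_)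
  rw [← sub_mul, norm_mul]
  have h1 := norm_mvAeval_sub_le (Q l) (hE l) hM x y hx hy
  have h2 : ‖w ^ (l : ℕ)‖ ≤ max 1 ‖w‖ ^ L := by
    rw [norm_pow]
    exact (pow_le_pow_left₀ (norm_nonneg _) (le_max_right _ _) _).trans
      (pow_le_pow_right₀ (le_max_left _ _) (Nat.lt_succ_iff.mp l.2))
  have h3 : 0 ≤ (lenMv (Q l) : ℝ) := by exact_mod_cast lenMv_nonneg _
  have h4 : 0 ≤ (E * M ^ (3 * E) * ∑ i, ‖x i - y i‖) := by positivity
  calc ‖MvPolynomial.aeval x (Q l) - MvPolynomial.aeval y (Q l)‖ * ‖w ^ (l : ℕ)‖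
      ≤ (lenMv (Q l) * (E * M ^ (3 * E) * ∑ i, ‖x i - y i‖)) * max 1 ‖w‖ ^ L := by gcongr
    _ = (lenMv (Q l) : ℝ) * max 1 ‖w‖ ^ L * (E * M ^ (3 * E) * ∑ i, ‖x i - y i‖) := by ring

/-! ## KS 6. Step 0: integer relations from the algebraic hypotheses -/

/-- A dependent triple satisfies a nonzero INTEGER polynomial relation. -/
theorem exists_int_mvRelation {x : Fin 3 → ℂ} (h : ¬ AlgebraicIndependent ℚ x) :
    ∃ P : MvPolynomial (Fin 3) ℤ, P ≠ 0 ∧ MvPolynomial.aeval x P = 0 := by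
  rw [algebraicIndependent_iff] at h
  push Not at h
  obtain ⟨P, hP, hP0⟩ := h
  obtain ⟨c, Q, hc, hQ⟩ := exists_int_mul_mvPolynomial P
  refine ⟨Q, ?_, ?_⟩
  · intro hQ0
    rw [hQ0, map_zero, eq_comm, mul_eq_zero] at hQ
    rcases hQ with h | h
    · exact hc (by exact_mod_cast (MvPolynomial.C_eq_zero.mp h))
    · exact hP0 h
  · have e : MvPolynomial.aeval x Q = MvPolynomial.aeval x (MvPolynomial.map (algebraMap ℤ ℚ) Q) := by
      rw [MvPolynomial.aeval_map_algebraMap]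
    rw [e, show algebraMap ℤ ℚ = Int.castRingHom ℚ from rfl, hQ, map_mul, hP, mul_zero]

/-- An element algebraic over `ℚ[x₀, x₁, x₂]` satisfies `Σ_{l ≤ L} Q_l(x) u^l = 0` with INTEGER
polynomials `Q_l`, `Q_L(x) ≠ 0` and `L ≥ 1` (when `u` itself is not a root of a constant). -/
theorem exists_int_mvRelation_alg {x : Fin 3 → ℂ} {u : ℂ}
    (halg : IsAlgebraic (Algebra.adjoin ℚ (Set.range x)) u) :
    ∃ (L : ℕ) (Q : Fin (L + 1) → MvPolynomial (Fin 3) ℤ),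
      MvPolynomial.aeval x (Q (Fin.last L)) ≠ 0 ∧
      ∑ l : Fin (L + 1), MvPolynomial.aeval x (Q l) * u ^ (l : ℕ) = 0 ∧ 0 < L := by
  set A := Algebra.adjoin ℚ (Set.range x) with hA
  obtain ⟨T, hT0, hTu⟩ := halg
  have hcoef : ∀ l : ℕ, ∃ P : MvPolynomial (Fin 3) ℚ, MvPolynomial.aeval x P = ((T.coeff l : A) : ℂ) := by
    intro l
    have hm : ((T.coeff l : A) : ℂ) ∈ (MvPolynomial.aeval x : MvPolynomial (Fin 3) ℚ →ₐ[ℚ] ℂ).range :=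
      (Algebra.adjoin_range_eq_range_aeval ℚ x).le (T.coeff l).2
    exact (AlgHom.mem_range _).1 hm
  choose P hP using hcoef
  set L := T.natDegree with hL
  obtain ⟨c, Q, hc, hQ⟩ := exists_common_int_mul_mvPolynomial (fun l : Fin (L + 1) => P l)
  have haeval : ∀ l : Fin (L + 1), MvPolynomial.aeval x (Q l) = (c : ℂ) * ((T.coeff l : A) : ℂ) := by
    intro l
    have e : MvPolynomial.aeval x (Q l) = MvPolynomial.aeval x (MvPolynomial.map (algebraMap ℤ ℚ) (Q l)) := by
      rw [MvPolynomial.aeval_map_algebraMap]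
    rw [e, show algebraMap ℤ ℚ = Int.castRingHom ℚ from rfl, hQ, map_mul, hP, MvPolynomial.algHom_C]
    simp
  have hrel : ∑ l : Fin (L + 1), ((T.coeff l : A) : ℂ) * u ^ (l : ℕ) = 0 := by
    have h1 : aeval u T = ∑ i ∈ Finset.range (L + 1), ((T.coeff i : A) : ℂ) * u ^ i := by
      rw [Polynomial.aeval_def, Polynomial.eval₂_eq_sum_range]
      rfl
    rw [hTu, Finset.sum_range (fun i => ((T.coeff i : A) : ℂ) * u ^ i)] at h1
    exact h1.symm
  have hcC : (c : ℂ) ≠ 0 := by exact_mod_cast hc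
  refine ⟨L, Q, ?_, ?_, ?_⟩
  · rw [haeval, Fin.val_last]
    refine mul_ne_zero hcC ?_
    have h1 : (T.coeff L : A) ≠ 0 := by
      rw [hL]; exact Polynomial.leadingCoeff_ne_zero.mpr hT0
    intro h2
    apply h1
    exact Subtype.ext (by simpa using h2)
  · simp_rw [haeval, mul_assoc, ← Finset.mul_sum, hrel, mul_zero]
  · by_contra hL0
    push Not at hL0
    have hL0' : L = 0 := by omega
    have h1 : T = Polynomial.C (T.coeff 0) := Polynomial.eq_C_of_natDegree_eq_zero (hL ▸ hL0')
    rw [h1, aeval_C] at hTu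
    have h2 : (T.coeff 0 : A) = 0 := by
      have : ((T.coeff 0 : A) : ℂ) = 0 := by simpa using hTu
      exact Subtype.ext (by simpa using this)
    apply hT0
    rw [h1, h2, map_zero]
/-! ## KS 7. The currency `ε_k = exp(−q^k)` and absorption of moderate factors -/

/-- The currency identity `ε_{k+1} = ε_k^q` for `ε_k := exp(−Q^k)`, `Q = q`. -/
theorem exp_neg_pow_succ (Q : ℝ) (q : ℕ) (hQ : Q = q) (k : ℕ) :
    Real.exp (-(Q ^ (k + 1))) = Real.exp (-(Q ^ k)) ^ q := by
  rw [← Real.exp_nat_mul, pow_succ, hQ]; ring_nf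

/-- The currencies `ε_k := exp(−Q^k)` decrease in `k` for `Q ≥ 1`. -/
theorem exp_neg_pow_le_exp_neg_pow {Q : ℝ} (hQ : 1 ≤ Q) {j k : ℕ} (h : j ≤ k) :
    Real.exp (-(Q ^ k)) ≤ Real.exp (-(Q ^ j)) := by
  rw [Real.exp_le_exp, neg_le_neg_iff]
  exact pow_le_pow_right₀ hQ h

/-- Absorption: `B ≤ exp(Q^k)` and `Q ≥ 2` give `B · ε_{k+1} ≤ ε_k`. -/
theorem absorb {Q B : ℝ} (hQ : 2 ≤ Q) {k : ℕ} (hB : B ≤ Real.exp (Q ^ k)) :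
    B * Real.exp (-(Q ^ (k + 1))) ≤ Real.exp (-(Q ^ k)) := by
  have h1 : Q ^ k + Q ^ k ≤ Q ^ (k + 1) := by rw [pow_succ]; nlinarith [pow_nonneg (by linarith : (0:ℝ) ≤ Q) k]
  calc B * Real.exp (-(Q ^ (k + 1))) ≤ Real.exp (Q ^ k) * Real.exp (-(Q ^ (k + 1))) :=
        mul_le_mul_of_nonneg_right hB (Real.exp_nonneg _)
    _ = Real.exp (Q ^ k - Q ^ (k + 1)) := by rw [← Real.exp_add]; ring_nf
    _ ≤ Real.exp (-(Q ^ k)) := by rw [Real.exp_le_exp]; linarith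

/-- `exp(4 Q²) ≤ exp(Q^k)` for `k ≥ 3`, `Q ≥ 4`. -/
theorem exp_four_sq_le {Q : ℝ} (hQ : 4 ≤ Q) {k : ℕ} (hk : 3 ≤ k) :
    Real.exp (4 * Q ^ 2) ≤ Real.exp (Q ^ k) := by
  rw [Real.exp_le_exp]
  calc 4 * Q ^ 2 ≤ Q * Q ^ 2 := by gcongr
    _ = Q ^ 3 := by ring
    _ ≤ Q ^ k := pow_le_pow_right₀ (by linarith) hk

/-- A natural power of `q` is `≤ exp(q²)` once `q ≥` the exponent. -/
theorem natPow_le_exp_sq {q a : ℕ} (ha : a ≤ q) : ((q : ℝ)) ^ a ≤ Real.exp ((q : ℝ) ^ 2) := by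
  have h1 : (q : ℝ) ≤ Real.exp (q : ℝ) := by linarith [Real.add_one_le_exp (q : ℝ)]
  calc ((q : ℝ)) ^ a ≤ (Real.exp (q : ℝ)) ^ a := pow_le_pow_left₀ (Nat.cast_nonneg _) h1 _
    _ = Real.exp ((a : ℝ) * q) := by rw [← Real.exp_nat_mul]
    _ ≤ Real.exp ((q : ℝ) ^ 2) := by
        rw [Real.exp_le_exp, sq]
        exact mul_le_mul_of_nonneg_right (by exact_mod_cast ha) (Nat.cast_nonneg _)

/-- `W^{c q} ≤ exp(q²)` once `q ≥ c · W` (`W ≥ 1`). -/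
theorem constPow_le_exp_sq {W : ℝ} (hW : 1 ≤ W) {c q : ℕ} (hq : (c : ℝ) * W ≤ q) :
    W ^ (c * q) ≤ Real.exp ((q : ℝ) ^ 2) := by
  have hW0 : 0 < W := by linarith
  have e : W ^ (c * q) = Real.exp (((c * q : ℕ) : ℝ) * Real.log W) := by
    rw [Real.exp_nat_mul, Real.exp_log hW0]
  rw [e, Real.exp_le_exp]
  have hlog : Real.log W ≤ W := (Real.log_le_sub_one_of_pos hW0).trans (by linarith)
  have hlog0 : 0 ≤ Real.log W := Real.log_nonneg hW
  push_cast
  calc ((c : ℝ) * q) * Real.log W = (c * Real.log W) * q := by ring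
    _ ≤ (c * W) * q := by gcongr
    _ ≤ q * q := by gcongr
    _ = (q : ℝ) ^ 2 := by ring

/-- A real constant `K ≤ q` is `≤ exp(q²)`. -/
theorem const_le_exp_sq {K : ℝ} {q : ℕ} (hK : K ≤ q) : K ≤ Real.exp ((q : ℝ) ^ 2) := by
  have h1 : (q : ℝ) ≤ Real.exp (q : ℝ) := by linarith [Real.add_one_le_exp (q : ℝ)]
  refine hK.trans (h1.trans ?_)
  rw [Real.exp_le_exp]
  exact_mod_cast Nat.le_self_pow two_ne_zero q

/-- Product of four factors each `≤ exp(q²)` is `≤ exp(Q^k)` (`k ≥ 3`, `q ≥ 4`). -/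
theorem prod4_le_exp_pow {q : ℕ} (hq : 4 ≤ q) {k : ℕ} (hk : 3 ≤ k) {B₁ B₂ B₃ B₄ : ℝ}
    (_h0₁ : 0 ≤ B₁) (h0₂ : 0 ≤ B₂) (h0₃ : 0 ≤ B₃) (h0₄ : 0 ≤ B₄)
    (h₁ : B₁ ≤ Real.exp ((q : ℝ) ^ 2)) (h₂ : B₂ ≤ Real.exp ((q : ℝ) ^ 2))
    (h₃ : B₃ ≤ Real.exp ((q : ℝ) ^ 2)) (h₄ : B₄ ≤ Real.exp ((q : ℝ) ^ 2)) :
    B₁ * B₂ * B₃ * B₄ ≤ Real.exp (((q : ℝ)) ^ k) := by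
  have hQ : (4 : ℝ) ≤ q := by exact_mod_cast hq
  calc B₁ * B₂ * B₃ * B₄ ≤ Real.exp ((q : ℝ) ^ 2) * Real.exp ((q : ℝ) ^ 2) * Real.exp ((q : ℝ) ^ 2)
        * Real.exp ((q : ℝ) ^ 2) := by gcongr
    _ = Real.exp (4 * (q : ℝ) ^ 2) := by rw [← Real.exp_add, ← Real.exp_add, ← Real.exp_add]; ring_nf
    _ ≤ Real.exp ((q : ℝ) ^ k) := exp_four_sq_le hQ hk

end Summit.Schanuel.Schanuel.Theorems.RootDecomp1KGeneric
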